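import Summits.QuantumFields.YangMills.Theorems.IR.AfPincerUcCompactWitnessProducers
import Summits.QuantumFields.YangMills.Theorems.BalabanLadderNTReferenceTorusPackage
import HarnessLib

/-!
# Crux `IR` (stmt-QuantumFields-19354), line `af-pincer`, X-side: the R105-COMPACT KIT, III — the registered `NT` stub (v4T periodic
# reference) delivers `NTCpt`, and the route ASSEMBLES from the compact twins: `UV → UVSeamRecCpt → NTCpt → IRCpt → ROT → UVOtherGroups → YangMills`

Seat ym-19354-afpincer-s2 (generation 4).  Helper module for item `stmt-QuantumFields-19354` (`--supports stmt-QuantumFields-19354 --as helper`;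
it closes nothing).  Third file of the kit (`…IR.AfPincerUcCompactWitness`: `LowerBoundsCpt`, compat, `IRCpt`, lane (1)A without envelope ⇒
`IRCpt`; `…Producers`: femto package, unit transfer, transport, `UVSeamRecCpt` from the v4-F stubs).

* §1 the general-`G` producer: the REGISTERED skeleton of crux `NT` (stmt-QuantumFields-19353, v4T «periodic-reference», single stub
  `stub_refpkgT : RefPkgT`, composition `NT_of := Reference.nt_of_torusReferencePackage stub_refpkgT`) states its two-point witness with
  `tsupport v ⊆ closedBall 0 σ` — COMPACT.  `q2_floor_of_torusReference` is the explicit-witness form of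
  `Reference.lowerBounds_fst_of_torusReference` (same proof, the GIVEN `v`; the periodic twin of the NT desk's own `Reference.q2_floor_of_reference`);
  `lowerBoundsCpt_of_torusReferencePackage`; `NTCpt` (the text of `Theses.BalabanLadder.NT` with `LowerBoundsCpt`, STRONGER than the registered text:
  `nt_of_ntCpt`); **`ntCpt_of_torusReferencePackage`** — the text of `RefPkgT` ⇒ `NTCpt`.  So R105 (a) holds BY DECL for the registered `NT` line too.
* §2 **`yangMills_of_cptLegs : UV → UVSeamRecCpt → NTCpt → IRCpt → ROT → UVOtherGroups → YangMills`** — the route's deciding theorem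
  `Theses.BalabanLadder.closes` with the three re-typed binders (mirror proof through `Y2Bridge.yangMills_of_legs`; `ROT`, `UVOtherGroups` and the
  bridge consume `LowerBounds` via the compat lemma).  WHAT THE KIT SHOWS, in one sentence: re-typing `LowerBounds`(i) with a compactly supported witness
  (R105-compact) STRENGTHENS the producer items `NT` ∕ `UVSeamRec` to twins their registered stubs already prove (`ntCpt_of_torusReferencePackage`,
  `uvSeamRecCpt_of_stubs`), WEAKENS the consumer item `IR` to `IRCpt`, which lane (1)A closes WITHOUT the crossover envelope
  (`irCpt_of_laneAWindowContractSC`: format-at-scale + AF WINDOW + residual), and keeps the assembly (this theorem).  The decision is the owner's.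

HONEST FRAMING.  Kernel bookkeeping among OPEN statements (every stub, floor, ceiling, window and format named here is open); nothing of
non-triviality, asymptotic freedom, mixing or a gap is proved; legs 0/6; CONDITIONAL chain (Track A 0/28 UV); not Clay.  No `sorry`;
axioms ⊆ {propext, Classical.choice, Quot.sound}.
-/

set_option autoImplicit false

noncomputable section

open Filter Topology MeasureTheory
open scoped SchwartzMap
open Literature.MathematicalPhysics.QuantumFieldTheory hiding ZdEdge
open Literature.MathematicalPhysics.QuantumLattice
open Literature.Probability.LatticeModels
open Summit.QuantumFields.YangMills.Cruxes.OSLegsFromFemtoAndGap.DlrCollarTransfer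
open Summit.QuantumFields.YangMills.Cruxes.OSLegsFromFemtoAndGap.DlrCollarTransfer.StubLower
open Summit.QuantumFields.YangMills.Cruxes.NT.Reference
open Summit.QuantumFields.YangMills.Cruxes.UVSeamRec

namespace Summit.QuantumFields.YangMills.Cruxes.IR.AfPincerUc.Compact

/-! ## §1 The registered `NT` producer (v4T periodic reference package) delivers `NTCpt` -/
section TorusReference

variable (G : Type) [Group G] [TopologicalSpace G] [IsTopologicalGroup G] [CompactSpace G]
  [MeasurableSpace G] [BorelSpace G] (r : LatticeRep G)

/-- **Explicit-witness form of `Reference.lowerBounds_fst_of_torusReference`** (same proof, for the GIVEN test function): a unit map `a`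
(`0 < a`, `a → 0`); constants `C₁, C₂ ≥ 0`, femto scale `ℓ`, support radius `σ > 0`, collar `κ > 0` with `2(σ+κ) < ℓ`; (E1-osc), (E2-osc);
and for the given `v` supported in the ball of radius `σ`, the given `ε` and, for every `β ≥ β₅`, ONE torus `2L₀(β)+1` with `a β · L₀(β) ≥ σ + κ + 1`
on which `Q2_{β,L₀(β),aβ}(θv, v) ≥ ε +` margins.  Then `ε ≤ Q2_{β,L,aβ}(θv, v)` for all `β ≥ β₅'` and EVERY torus with `a β · L ≥ σ + κ + 1`.
[folklore] -/
theorem q2_floor_of_torusReference (a : ℝ → ℝ) (ha₀ : ∀ β, 0 < a β) (ha : Tendsto a atTop (𝓝 0))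
    {C₁ C₂ ℓ σ κ : ℝ} (hC₁ : 0 ≤ C₁) (hC₂ : 0 ≤ C₂) (hσ : 0 < σ) (hκ : 0 < κ) (hℓ : 2 * (σ + κ) < ℓ)
    (hE1 : ∃ β₁ : ℝ, ∀ β : ℝ, β₁ ≤ β → ∀ (c : Fin 4 → ℤ) (b : ℕ), (b : ℝ) * a β ≤ ℓ →
      ∀ (η η' : LGConfig 4 G) (x : Fin 4 → ℤ), 1 ≤ depth c b x →
        |kerE G r β c b η (dens G r x) - kerE G r β c b η' (dens G r x)| ≤ C₁ / (depth c b x : ℝ) ^ 4)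
    (hE2 : ∃ β₂ : ℝ, ∀ β : ℝ, β₂ ≤ β → ∀ (c : Fin 4 → ℤ) (b : ℕ), (b : ℝ) * a β ≤ ℓ →
      ∀ (η η' : LGConfig 4 G) (x y : Fin 4 → ℤ), 1 ≤ depth c b x → 1 ≤ depth c b y →
        |kerCov G r β c b η (dens G r x) (dens G r y) - kerCov G r β c b η' (dens G r x) (dens G r y)| ≤
          C₂ / ((min (depth c b x) (depth c b y) : ℕ) : ℝ) ^ 4 / (1 + ‖siteToE (y - x)‖) ^ 4)
    (v : 𝓢(EuclideanSpace ℝ (Fin 4), ℝ)) {ε β₅ : ℝ} (L₀ : ℝ → ℕ)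
    (hvσ : tsupport (v : EuclideanSpace ℝ (Fin 4) → ℝ) ⊆ Metric.closedBall 0 σ)
    (HR : ∀ β : ℝ, β₅ ≤ β → σ + κ + 1 ≤ a β * L₀ β ∧
        ε + 2 * (C₁ * (a β / κ) ^ 4 * ∑ x ∈ box 4 (L₀ β), |thetaTest 4 v (a β • siteToE x)|) *
              (C₁ * (a β / κ) ^ 4 * ∑ y ∈ box 4 (L₀ β), |v (a β • siteToE y)|) +
            C₂ * (a β / κ) ^ 4 * ∑ x ∈ box 4 (L₀ β), ∑ y ∈ box 4 (L₀ β),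
              |thetaTest 4 v (a β • siteToE x)| * |v (a β • siteToE y)| / (1 + ‖siteToE (y - x)‖) ^ 4 ≤
          Q2 G r β (L₀ β) (a β) (thetaTest 4 v) v) :
    ∃ β₅' : ℝ, ∀ β : ℝ, β₅' ≤ β → ∀ L : ℕ, σ + κ + 1 ≤ a β * L → ε ≤ Q2 G r β L (a β) (thetaTest 4 v) v := by
  obtain ⟨β₁, H1⟩ := hE1
  obtain ⟨β₂, H2⟩ := hE2
  have hδ : 0 < min (1 / 4 : ℝ) ((ℓ - 2 * (σ + κ)) / 5) := lt_min (by norm_num) (by linarith)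
  obtain ⟨βa, Ha⟩ := eventually_le_of_tendsto ha hδ
  refine ⟨max (max β₅ βa) (max β₁ β₂), fun β hβ L hL => ?_⟩
  have hβ₅ : β₅ ≤ β := le_trans (le_max_left _ _) (le_trans (le_max_left _ _) hβ)
  have hβa : βa ≤ β := le_trans (le_max_right _ _) (le_trans (le_max_left _ _) hβ)
  have hβ₁ : β₁ ≤ β := le_trans (le_max_left _ _) (le_trans (le_max_right _ _) hβ)
  have hβ₂ : β₂ ≤ β := le_trans (le_max_right _ _) (le_trans (le_max_right _ _) hβ)
  have hα : 0 < a β := ha₀ β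
  have hsmall := Ha β hβa
  have h4 : a β ≤ 1 / 4 := hsmall.trans (min_le_left _ _)
  have hℓ' : a β ≤ (ℓ - 2 * (σ + κ)) / 5 := hsmall.trans (min_le_right _ _)
  have hρ' : a β ≤ ((σ + κ + 2 * a β) - σ - κ) / 2 := by linarith
  obtain ⟨hL₀, HRβ⟩ := HR β hβ₅
  obtain ⟨-, hfem, hLL, hNL, -, hdep⟩ := scales hα hσ hκ h4 hρ' hℓ' hL (RP := ⌈(σ + κ) / a β⌉₊ + 1) rfl
  obtain ⟨-, -, hLL₀, hNL₀, -, -⟩ := scales hα hσ hκ h4 hρ' hℓ' hL₀ (RP := ⌈(σ + κ) / a β⌉₊ + 1) rfl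
  set N := ⌈σ / a β⌉₊ with hN
  have hθ0 : ∀ x, x ∉ box 4 N → thetaTest 4 v (a β • siteToE x) = 0 := fun x hx =>
    thetaTest_smul_siteToE_eq_zero hα hvσ hx
  have hw0 : ∀ y, y ∉ box 4 N → v (a β • siteToE y) = 0 := fun y hy =>
    apply_smul_siteToE_eq_zero hα hvσ hy
  -- per-pair torus-to-torus transfer
  have hpair : ∀ x ∈ box 4 N, ∀ y ∈ box 4 N,
      |(torusE G r β L (fun U => dens G r x U * dens G r y U) - torusE G r β L (dens G r x) * torusE G r β L (dens G r y))
        - (torusE G r β (L₀ β) (fun U => dens G r x U * dens G r y U) -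
            torusE G r β (L₀ β) (dens G r x) * torusE G r β (L₀ β) (dens G r y))| ≤
      2 * (C₁ * (a β / κ) ^ 4) * (C₁ * (a β / κ) ^ 4) + C₂ * (a β / κ) ^ 4 / (1 + ‖siteToE (y - x)‖) ^ 4 :=
    fun x hx y hy => pair_transfer_torus G r β hC₁ hC₂ hκ hα hfem hLL hLL₀ hdep (H1 β hβ₁) (H2 β hβ₂) hx hy
  -- the sums restricted to the support box
  have eQ : ∀ M : ℕ, N ≤ M → Q2 G r β M (a β) (thetaTest 4 v) v = ∑ x ∈ box 4 N, ∑ y ∈ box 4 N,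
      thetaTest 4 v (a β • siteToE x) * v (a β • siteToE y) *
        (torusE G r β M (fun U => dens G r x U * dens G r y U) -
          torusE G r β M (dens G r x) * torusE G r β M (dens G r y)) := fun M hM => by
    unfold Q2
    exact sum_box₂_eq hM _ (fun x hx y => by rw [hθ0 x hx]; ring) (fun y hy x => by rw [hw0 y hy]; ring)
  have e1 : ∑ x ∈ box 4 (L₀ β), |thetaTest 4 v (a β • siteToE x)| =
      ∑ x ∈ box 4 N, |thetaTest 4 v (a β • siteToE x)| :=
    sum_box_eq_sum_box hNL₀ _ fun x hx => by rw [hθ0 x hx, abs_zero]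
  have e2 : ∑ y ∈ box 4 (L₀ β), |v (a β • siteToE y)| = ∑ y ∈ box 4 N, |v (a β • siteToE y)| :=
    sum_box_eq_sum_box hNL₀ _ fun y hy => by rw [hw0 y hy, abs_zero]
  have e3 : ∑ x ∈ box 4 (L₀ β), ∑ y ∈ box 4 (L₀ β),
      |thetaTest 4 v (a β • siteToE x)| * |v (a β • siteToE y)| / (1 + ‖siteToE (y - x)‖) ^ 4 =
      ∑ x ∈ box 4 N, ∑ y ∈ box 4 N,
      |thetaTest 4 v (a β • siteToE x)| * |v (a β • siteToE y)| / (1 + ‖siteToE (y - x)‖) ^ 4 :=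
    sum_box₂_eq hNL₀ _ (fun x hx y => by rw [hθ0 x hx, abs_zero, zero_mul, zero_div])
      (fun y hy x => by rw [hw0 y hy, abs_zero, mul_zero, zero_div])
  have hsum := sum_sum_sub_le_of_abs_sub_le (box 4 N) (fun x => thetaTest 4 v (a β • siteToE x))
    (fun y => v (a β • siteToE y))
    (fun x y => torusE G r β L (fun U => dens G r x U * dens G r y U) -
      torusE G r β L (dens G r x) * torusE G r β L (dens G r y))
    (fun x y => torusE G r β (L₀ β) (fun U => dens G r x U * dens G r y U) -
      torusE G r β (L₀ β) (dens G r x) * torusE G r β (L₀ β) (dens G r y))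
    (fun x y => C₂ * (a β / κ) ^ 4 / (1 + ‖siteToE (y - x)‖) ^ 4)
    (2 * (C₁ * (a β / κ) ^ 4) * (C₁ * (a β / κ) ^ 4)) hpair
  have e4 : ∑ x ∈ box 4 N, ∑ y ∈ box 4 N, |thetaTest 4 v (a β • siteToE x)| * |v (a β • siteToE y)| *
      (C₂ * (a β / κ) ^ 4 / (1 + ‖siteToE (y - x)‖) ^ 4) =
      C₂ * (a β / κ) ^ 4 * ∑ x ∈ box 4 N, ∑ y ∈ box 4 N,
        |thetaTest 4 v (a β • siteToE x)| * |v (a β • siteToE y)| / (1 + ‖siteToE (y - x)‖) ^ 4 := by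
    rw [Finset.mul_sum]
    refine Finset.sum_congr rfl fun x _ => ?_
    rw [Finset.mul_sum]
    refine Finset.sum_congr rfl fun y _ => ?_
    ring
  rw [eQ (L₀ β) hNL₀, e1, e2, e3] at HRβ
  rw [e4] at hsum
  rw [eQ L hNL]
  have hprod : 2 * (C₁ * (a β / κ) ^ 4 * ∑ x ∈ box 4 N, |thetaTest 4 v (a β • siteToE x)|) *
      (C₁ * (a β / κ) ^ 4 * ∑ y ∈ box 4 N, |v (a β • siteToE y)|) =
      2 * (C₁ * (a β / κ) ^ 4) * (C₁ * (a β / κ) ^ 4) *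
        ((∑ x ∈ box 4 N, |thetaTest 4 v (a β • siteToE x)|) * ∑ y ∈ box 4 N, |v (a β • siteToE y)|) := by ring
  linarith [hsum, HRβ, hprod]

/-- **`LowerBoundsCpt` from the periodic reference package** (`Reference.lowerBounds_of_torusReferencePackage` with the two-point witness's compact
support recorded: `tsupport v ⊆ closedBall 0 σ` is compact in `E⁴`).  Units + (E1/E2/E3-osc) + (R2-torus) + (R3-torus) ⇒ `LowerBoundsCpt G r a`.
[folklore] -/
theorem lowerBoundsCpt_of_torusReferencePackage (a : ℝ → ℝ) (ha₀ : ∀ β, 0 < a β) (ha : Tendsto a atTop (𝓝 0))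
    {C₁ C₂ C₃ ℓ σ κ : ℝ} (hC₁ : 0 ≤ C₁) (hC₂ : 0 ≤ C₂) (hC₃ : 0 ≤ C₃) (hσ : 0 < σ) (hκ : 0 < κ)
    (hℓ : 2 * (σ + κ) < ℓ)
    (hE1 : ∃ β₁ : ℝ, ∀ β : ℝ, β₁ ≤ β → ∀ (c : Fin 4 → ℤ) (b : ℕ), (b : ℝ) * a β ≤ ℓ →
      ∀ (η η' : LGConfig 4 G) (x : Fin 4 → ℤ), 1 ≤ depth c b x →
        |kerE G r β c b η (dens G r x) - kerE G r β c b η' (dens G r x)| ≤ C₁ / (depth c b x : ℝ) ^ 4)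
    (hE2 : ∃ β₂ : ℝ, ∀ β : ℝ, β₂ ≤ β → ∀ (c : Fin 4 → ℤ) (b : ℕ), (b : ℝ) * a β ≤ ℓ →
      ∀ (η η' : LGConfig 4 G) (x y : Fin 4 → ℤ), 1 ≤ depth c b x → 1 ≤ depth c b y →
        |kerCov G r β c b η (dens G r x) (dens G r y) - kerCov G r β c b η' (dens G r x) (dens G r y)| ≤
          C₂ / ((min (depth c b x) (depth c b y) : ℕ) : ℝ) ^ 4 / (1 + ‖siteToE (y - x)‖) ^ 4)
    (hE3 : ∃ β₃ : ℝ, ∀ β : ℝ, β₃ ≤ β → ∀ (c : Fin 4 → ℤ) (b : ℕ), (b : ℝ) * a β ≤ ℓ →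
      ∀ (η η' : LGConfig 4 G) (x y z : Fin 4 → ℤ), 1 ≤ depth c b x → 1 ≤ depth c b y → 1 ≤ depth c b z →
        |kerK3 G r β c b η x y z - kerK3 G r β c b η' x y z| ≤
          C₃ / ((min (min (depth c b x) (depth c b y)) (depth c b z) : ℕ) : ℝ) ^ 4 /
            (1 + min (min ‖siteToE (y - x)‖ ‖siteToE (z - y)‖) ‖siteToE (z - x)‖) ^ 8)
    (hR2 : ∃ (v : 𝓢(EuclideanSpace ℝ (Fin 4), ℝ)) (ε β₅ : ℝ) (L₀ : ℝ → ℕ),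
      tsupport (v : EuclideanSpace ℝ (Fin 4) → ℝ) ⊆ {y | 0 < y 0} ∧
      tsupport (v : EuclideanSpace ℝ (Fin 4) → ℝ) ⊆ Metric.closedBall 0 σ ∧ 0 < ε ∧
      ∀ β : ℝ, β₅ ≤ β → σ + κ + 1 ≤ a β * L₀ β ∧
        ε + 2 * (C₁ * (a β / κ) ^ 4 * ∑ x ∈ box 4 (L₀ β), |thetaTest 4 v (a β • siteToE x)|) *
              (C₁ * (a β / κ) ^ 4 * ∑ y ∈ box 4 (L₀ β), |v (a β • siteToE y)|) +
            C₂ * (a β / κ) ^ 4 * ∑ x ∈ box 4 (L₀ β), ∑ y ∈ box 4 (L₀ β),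
              |thetaTest 4 v (a β • siteToE x)| * |v (a β • siteToE y)| / (1 + ‖siteToE (y - x)‖) ^ 4 ≤
          Q2 G r β (L₀ β) (a β) (thetaTest 4 v) v)
    (hR3 : ∃ (f g h : 𝓢(EuclideanSpace ℝ (Fin 4), ℝ)) (ε β₅ : ℝ) (L₀ : ℝ → ℕ),
      Disjoint (tsupport (f : EuclideanSpace ℝ (Fin 4) → ℝ)) (tsupport (g : EuclideanSpace ℝ (Fin 4) → ℝ)) ∧
      Disjoint (tsupport (g : EuclideanSpace ℝ (Fin 4) → ℝ)) (tsupport (h : EuclideanSpace ℝ (Fin 4) → ℝ)) ∧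
      Disjoint (tsupport (f : EuclideanSpace ℝ (Fin 4) → ℝ)) (tsupport (h : EuclideanSpace ℝ (Fin 4) → ℝ)) ∧
      tsupport (f : EuclideanSpace ℝ (Fin 4) → ℝ) ⊆ Metric.closedBall 0 σ ∧
      tsupport (g : EuclideanSpace ℝ (Fin 4) → ℝ) ⊆ Metric.closedBall 0 σ ∧
      tsupport (h : EuclideanSpace ℝ (Fin 4) → ℝ) ⊆ Metric.closedBall 0 σ ∧ 0 < ε ∧
      ∀ β : ℝ, β₅ ≤ β → σ + κ + 1 ≤ a β * L₀ β ∧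
        ε + ∑ x ∈ box 4 (L₀ β), ∑ y ∈ box 4 (L₀ β), ∑ z ∈ box 4 (L₀ β),
            |f (a β • siteToE x)| * |g (a β • siteToE y)| * |h (a β • siteToE z)| *
              (2 * ((C₁ * (a β / κ) ^ 4) * (C₂ * (a β / κ) ^ 4 / (1 + ‖siteToE (z - y)‖) ^ 4) +
                    (C₁ * (a β / κ) ^ 4) * (C₂ * (a β / κ) ^ 4 / (1 + ‖siteToE (z - x)‖) ^ 4) +
                    (C₁ * (a β / κ) ^ 4) * (C₂ * (a β / κ) ^ 4 / (1 + ‖siteToE (y - x)‖) ^ 4) +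
                    (C₁ * (a β / κ) ^ 4) * (C₁ * (a β / κ) ^ 4) * (C₁ * (a β / κ) ^ 4)) +
                C₃ * (a β / κ) ^ 4 / (1 + min (min ‖siteToE (y - x)‖ ‖siteToE (z - y)‖) ‖siteToE (z - x)‖) ^ 8) ≤
          |Q3 G r β (L₀ β) (a β) f g h|) :
    LowerBoundsCpt G r a := by
  refine lowerBoundsCpt_of_lowerBounds_of_compactWitness
    (lowerBounds_of_torusReferencePackage G r a ha₀ ha hC₁ hC₂ hC₃ hσ hκ hℓ hE1 hE2 hE3 hR2 hR3) ?_
  obtain ⟨v, ε, β₅, L₀, hvpos, hvσ, hε, HR⟩ := hR2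
  obtain ⟨β₅', H⟩ := q2_floor_of_torusReference G r a ha₀ ha hC₁ hC₂ hσ hκ hℓ hE1 hE2 v L₀ hvσ HR
  exact ⟨v, ε, β₅', σ + κ + 1, (isCompact_closedBall _ _).of_isClosed_subset (isClosed_tsupport _) hvσ,
    hvpos, hε, H⟩

end TorusReference

/-- **`NTCpt` — the text of `Theses.BalabanLadder.NT` (stmt-QuantumFields-19353) with `LowerBoundsCpt`:** for every compact simple `G` some `(r, a)`
(`0 < a`, `a → 0`) carrying the floors with a COMPACTLY SUPPORTED two-point witness.  STRONGER than the registered text (`nt_of_ntCpt`); already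
implied by the registered v4T stub (`ntCpt_of_torusReferencePackage`). -/
def NTCpt : Prop :=
  ∀ (G : Type) [Group G] [TopologicalSpace G] [IsTopologicalGroup G] [CompactSpace G],
    IsCompactSimpleLieGroup G → letI : MeasurableSpace G := borel G; haveI : BorelSpace G := ⟨rfl⟩;
    ∃ (r : LatticeRep G) (a : ℝ → ℝ), (∀ β, 0 < a β) ∧ Tendsto a atTop (𝓝 0) ∧ LowerBoundsCpt G r a

/-- **Monotonicity: `NTCpt → NT`** (the registered text, by the compat lemma). [bookkeeping] -/
theorem nt_of_ntCpt (h : NTCpt) : Summit.QuantumFields.YangMills.Theses.BalabanLadder.NT := by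
  intro G _ _ _ _ hG
  letI : MeasurableSpace G := borel G
  haveI : BorelSpace G := ⟨rfl⟩
  obtain ⟨r, a, ha, ha0, hlbc⟩ := h G hG
  exact ⟨r, a, ha, ha0, lowerBounds_of_lowerBoundsCpt hlbc⟩

/-- **The text of the registered `NT` stub `stub_refpkgT : RefPkgT` (skeleton v4T «periodic-reference», 4297522f58b4c3a5) gives `NTCpt`** — mirror
of the skeleton's composition `Reference.nt_of_torusReferencePackage` with the compact support of the two-point witness kept
(`lowerBoundsCpt_of_torusReferencePackage`).  So the general-`G` producer loses nothing under R105-compact. [kernel composition; the package is OPEN] -/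
theorem ntCpt_of_torusReferencePackage
    (h : ∀ (G : Type) [Group G] [TopologicalSpace G] [IsTopologicalGroup G] [CompactSpace G],
      IsCompactSimpleLieGroup G → letI : MeasurableSpace G := borel G; haveI : BorelSpace G := ⟨rfl⟩;
      ∃ (r : LatticeRep G) (a : ℝ → ℝ), (∀ β, 0 < a β) ∧ Tendsto a atTop (𝓝 0) ∧
      ∃ (C₁ C₂ C₃ ℓ σ κ : ℝ), 0 ≤ C₁ ∧ 0 ≤ C₂ ∧ 0 ≤ C₃ ∧ 0 < σ ∧ 0 < κ ∧ 2 * (σ + κ) < ℓ ∧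
      (∃ β₁ : ℝ, ∀ β : ℝ, β₁ ≤ β → ∀ (c : Fin 4 → ℤ) (b : ℕ), (b : ℝ) * a β ≤ ℓ →
        ∀ (η η' : LGConfig 4 G) (x : Fin 4 → ℤ), 1 ≤ depth c b x →
          |kerE G r β c b η (dens G r x) - kerE G r β c b η' (dens G r x)| ≤ C₁ / (depth c b x : ℝ) ^ 4) ∧
      (∃ β₂ : ℝ, ∀ β : ℝ, β₂ ≤ β → ∀ (c : Fin 4 → ℤ) (b : ℕ), (b : ℝ) * a β ≤ ℓ →
        ∀ (η η' : LGConfig 4 G) (x y : Fin 4 → ℤ), 1 ≤ depth c b x → 1 ≤ depth c b y →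
          |kerCov G r β c b η (dens G r x) (dens G r y) - kerCov G r β c b η' (dens G r x) (dens G r y)| ≤
            C₂ / ((min (depth c b x) (depth c b y) : ℕ) : ℝ) ^ 4 / (1 + ‖siteToE (y - x)‖) ^ 4) ∧
      (∃ β₃ : ℝ, ∀ β : ℝ, β₃ ≤ β → ∀ (c : Fin 4 → ℤ) (b : ℕ), (b : ℝ) * a β ≤ ℓ →
        ∀ (η η' : LGConfig 4 G) (x y z : Fin 4 → ℤ), 1 ≤ depth c b x → 1 ≤ depth c b y → 1 ≤ depth c b z →
          |kerK3 G r β c b η x y z - kerK3 G r β c b η' x y z| ≤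
            C₃ / ((min (min (depth c b x) (depth c b y)) (depth c b z) : ℕ) : ℝ) ^ 4 /
              (1 + min (min ‖siteToE (y - x)‖ ‖siteToE (z - y)‖) ‖siteToE (z - x)‖) ^ 8) ∧
      (∃ (v : 𝓢(EuclideanSpace ℝ (Fin 4), ℝ)) (ε β₅ : ℝ) (L₀ : ℝ → ℕ),
        tsupport (v : EuclideanSpace ℝ (Fin 4) → ℝ) ⊆ {y | 0 < y 0} ∧
        tsupport (v : EuclideanSpace ℝ (Fin 4) → ℝ) ⊆ Metric.closedBall 0 σ ∧ 0 < ε ∧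
        ∀ β : ℝ, β₅ ≤ β → σ + κ + 1 ≤ a β * L₀ β ∧
          ε + 2 * (C₁ * (a β / κ) ^ 4 * ∑ x ∈ box 4 (L₀ β), |thetaTest 4 v (a β • siteToE x)|) *
                (C₁ * (a β / κ) ^ 4 * ∑ y ∈ box 4 (L₀ β), |v (a β • siteToE y)|) +
              C₂ * (a β / κ) ^ 4 * ∑ x ∈ box 4 (L₀ β), ∑ y ∈ box 4 (L₀ β),
                |thetaTest 4 v (a β • siteToE x)| * |v (a β • siteToE y)| / (1 + ‖siteToE (y - x)‖) ^ 4 ≤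
            Q2 G r β (L₀ β) (a β) (thetaTest 4 v) v) ∧
      (∃ (f g h : 𝓢(EuclideanSpace ℝ (Fin 4), ℝ)) (ε β₅ : ℝ) (L₀ : ℝ → ℕ),
        Disjoint (tsupport (f : EuclideanSpace ℝ (Fin 4) → ℝ)) (tsupport (g : EuclideanSpace ℝ (Fin 4) → ℝ)) ∧
        Disjoint (tsupport (g : EuclideanSpace ℝ (Fin 4) → ℝ)) (tsupport (h : EuclideanSpace ℝ (Fin 4) → ℝ)) ∧
        Disjoint (tsupport (f : EuclideanSpace ℝ (Fin 4) → ℝ)) (tsupport (h : EuclideanSpace ℝ (Fin 4) → ℝ)) ∧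
        tsupport (f : EuclideanSpace ℝ (Fin 4) → ℝ) ⊆ Metric.closedBall 0 σ ∧
        tsupport (g : EuclideanSpace ℝ (Fin 4) → ℝ) ⊆ Metric.closedBall 0 σ ∧
        tsupport (h : EuclideanSpace ℝ (Fin 4) → ℝ) ⊆ Metric.closedBall 0 σ ∧ 0 < ε ∧
        ∀ β : ℝ, β₅ ≤ β → σ + κ + 1 ≤ a β * L₀ β ∧
          ε + ∑ x ∈ box 4 (L₀ β), ∑ y ∈ box 4 (L₀ β), ∑ z ∈ box 4 (L₀ β),
              |f (a β • siteToE x)| * |g (a β • siteToE y)| * |h (a β • siteToE z)| *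
                (2 * ((C₁ * (a β / κ) ^ 4) * (C₂ * (a β / κ) ^ 4 / (1 + ‖siteToE (z - y)‖) ^ 4) +
                      (C₁ * (a β / κ) ^ 4) * (C₂ * (a β / κ) ^ 4 / (1 + ‖siteToE (z - x)‖) ^ 4) +
                      (C₁ * (a β / κ) ^ 4) * (C₂ * (a β / κ) ^ 4 / (1 + ‖siteToE (y - x)‖) ^ 4) +
                      (C₁ * (a β / κ) ^ 4) * (C₁ * (a β / κ) ^ 4) * (C₁ * (a β / κ) ^ 4)) +
                  C₃ * (a β / κ) ^ 4 /
                    (1 + min (min ‖siteToE (y - x)‖ ‖siteToE (z - y)‖) ‖siteToE (z - x)‖) ^ 8) ≤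
            |Q3 G r β (L₀ β) (a β) f g h|)) :
    NTCpt := by
  intro G _ _ _ _ hG
  letI : MeasurableSpace G := borel G
  haveI : BorelSpace G := ⟨rfl⟩
  obtain ⟨r, a, ha₀, ha, C₁, C₂, C₃, ℓ, σ, κ, hC₁, hC₂, hC₃, hσ, hκ, hℓ, hE1, hE2, hE3, hR2, hR3⟩ := h G hG
  exact ⟨r, a, ha₀, ha, lowerBoundsCpt_of_torusReferencePackage G r a ha₀ ha hC₁ hC₂ hC₃ hσ hκ hℓ hE1 hE2 hE3 hR2 hR3⟩

/-- The femto-package form of the same producer fact (crux `NT` skeleton v2 currency `CFP` / line `dlr-collar-transfer`): for every compact simple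
`G` some `(r, a)` with units and `FBL ∧ FC2 ∧ FC3` ⇒ `NTCpt` (`lowerBoundsCpt_of_femtoPackage`). [kernel composition; the package is OPEN] -/
theorem ntCpt_of_femtoPackage
    (h : ∀ (G : Type) [Group G] [TopologicalSpace G] [IsTopologicalGroup G] [CompactSpace G],
      IsCompactSimpleLieGroup G → letI : MeasurableSpace G := borel G; haveI : BorelSpace G := ⟨rfl⟩;
      ∃ (r : LatticeRep G) (a : ℝ → ℝ), (∀ β, 0 < a β) ∧ Tendsto a atTop (𝓝 0) ∧ FBL G r a ∧ FC2 G r a ∧ FC3 G r a) :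
    NTCpt := by
  intro G _ _ _ _ hG
  letI : MeasurableSpace G := borel G
  haveI : BorelSpace G := ⟨rfl⟩
  obtain ⟨r, a, ha₀, ha, hFBL, hFC2, hFC3⟩ := h G hG
  exact ⟨r, a, ha₀, ha, lowerBoundsCpt_of_femtoPackage G r a ha₀ ha hFBL hFC2 hFC3⟩

/-! ## §2 The route assembles from the compact twins -/

/-- **The deciding theorem of route `BalabanLadder` under R105-compact (PROVED):**
`UV → UVSeamRecCpt → NTCpt → IRCpt → ROT → UVOtherGroups → YangMills` — the route file's `closes` with the three binders re-typed (`LowerBounds`(i) with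
a compactly supported witness), same composition through `Y2Bridge.yangMills_of_legs`: on the `SU(2)` class the seam gives `(r, uRec)` with
compact-witness floors and ceilings, elsewhere `NTCpt` gives `(r, a)`; `IRCpt` consumes the compact floors; `ROT`, `UVOtherGroups` and the bridge
consume the plain floors through `lowerBounds_of_lowerBoundsCpt`.  With `uvSeamRecCpt_of_stubs`, `ntCpt_of_torusReferencePackage` and
`irCpt_of_laneAWindowContractSC` this is the whole kernel content of the R105-compact candidate: NOTHING upstream changes, and lane (1)A of crux
`IR` owes the AF WINDOW (plus format-at-scale and the residual) with NO envelope. [kernel composition; every binder is OPEN] -/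
theorem yangMills_of_cptLegs (hUV : Summit.QuantumFields.YangMills.Theses.BalabanLadder.UV) (hSeam : UVSeamRecCpt) (hNT : NTCpt)
    (hIR : IRCpt) (hROT : Summit.QuantumFields.YangMills.Theses.BalabanLadder.ROT)
    (hOther : Summit.QuantumFields.YangMills.Theses.BalabanLadder.UVOtherGroups) : YangMills := by
  refine Summit.QuantumFields.YangMills.Cruxes.OSLegsAtWeakCouplingC.Y2Bridge.yangMills_of_legs ?_
  intro G _ _ _ _ hG
  letI : MeasurableSpace G := borel G
  haveI : BorelSpace G := ⟨rfl⟩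
  by_cases hcl : Nonempty (G ≃ₜ* Matrix.specialUnitaryGroup (Fin 2) ℂ)
  · obtain ⟨r, hlbc, hmb⟩ := hSeam hUV G hG hcl
    have hlb := lowerBounds_of_lowerBoundsCpt hlbc
    exact ⟨r, _, UnitTransfer.uRec_pos, UnitTransfer.tendsto_uRec, hmb, hlb,
      hIR G hG r _ UnitTransfer.uRec_pos UnitTransfer.tendsto_uRec hlbc,
      hROT G hG r _ UnitTransfer.uRec_pos UnitTransfer.tendsto_uRec hlb hmb⟩
  · obtain ⟨r, a, ha, ha0, hlbc⟩ := hNT G hG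
    have hlb := lowerBounds_of_lowerBoundsCpt hlbc
    have hmb := hOther G hG (not_nonempty_iff.mp hcl) r a ha ha0 hlb
    exact ⟨r, a, ha, ha0, hmb, hlb, hIR G hG r a ha ha0 hlbc, hROT G hG r a ha ha0 hlb hmb⟩

/-- **The same with the REGISTERED producer texts** (`UVSeamRec`, `NT` as typed today are NOT enough — they forget compactness — but the kit's producer
theorems are): `UV`, the v4-F seam stubs' conclusion in compact form, `NTCpt`, lane (1)A WITHOUT ENVELOPE, the registered residual, `ROT`, `UVOtherGroups`
⊢ `YangMills`. [kernel composition; every binder is OPEN] -/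
theorem yangMills_of_laneAWindow (hUV : Summit.QuantumFields.YangMills.Theses.BalabanLadder.UV) (hSeam : UVSeamRecCpt) (hNT : NTCpt)
    (hA : LaneAWindowContractSC) (hN : SharpOnset.IRNSC) (hROT : Summit.QuantumFields.YangMills.Theses.BalabanLadder.ROT)
    (hOther : Summit.QuantumFields.YangMills.Theses.BalabanLadder.UVOtherGroups) : YangMills :=
  yangMills_of_cptLegs hUV hSeam hNT (irCpt_of_laneAWindowContractSC_of_irNSC hA hN) hROT hOther

end Summit.QuantumFields.YangMills.Cruxes.IR.AfPincerUc.Compact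

end
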